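import Summits.AtomisticToContinuum.BoseEinsteinCondensation.Theorems.GroundStateRigidity.Negative.TwoHardSpheresLocalisation
import Literature.MathematicalPhysics.QuantumManyBody.BoseGasClusterStates
import Summits.AtomisticToContinuum.BoseEinsteinCondensation.Theorems.BECCutLineWeakDisorderGroundStateRigidityStubCompactness
import Summits.AtomisticToContinuum.BoseEinsteinCondensation.Theorems.BECCutLineWeakDisorderGroundStateRigidityStubRigidityOfUnique
import HarnessLib

/-!
# Two unit hard spheres in a box with `1/3 < L² < 1/2`: finite energy, NO rigidity, degenerate ground state

`GroundStateRigidity` (crux stmt-AtomisticToContinuum-9072, shared by 8 routes of `BoseEinsteinCondensation`):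
negative-side support, last of the four files
`Negative/BoxReflection.lean` → `Negative/TwoHardSpheresSupport.lean` → `Negative/TwoHardSpheresLocalisation.lean`
→ `Negative/TwoHardSpheres.lean` (kernel-checked by the crux disprover `refuter-cdisprove-stmt-AtomisticToContinuum-9072-0`
as §4 of `Cruxes/GroundStateRigidity/Disproof.lean`, 2026-08-16; landed, with the rigidity predicate written out and the
closing corollary made unconditional, by the line lead c1).

Results (`v = hardSphere = ⊤·1_{[0,1]}`, an admissible interaction; `N = 2`):

* `groundStateEnergy_two_ne_top` — `E₀(2, L) < ⊤` once `3L² > 1` (symmetrised product of one-particle states near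
  the opposite corners `0` and `(L,L,L)`, `TrialState.combine`).
* `exists_disjoint_pair`, `not_rigid_two_hardSpheres` — for `1/3 < L² < 1/2` rigidity of near-minimisers FAILS at
  `(hardSphere, 2, L)`: finite energy forces `Ψ = 0` on `{|x₁-x₂| < 1}`, so `Ψ` lives on `{|q| > 1 - 2L²}`
  (`q = (x₁-x₂)₀(x₁-x₂)₁`, Bose-symmetric, odd under `x₀ ↦ L - x₀`); localising any near-minimiser to the heavier
  of the two classes `{q > 0}`, `{q < 0}` (flat cut-off, mass `≥ 1/2`, slack at most doubles) and reflecting it gives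
  two DISJOINTLY supported near-minimisers at every slack, at squared `L²`-distance `2` for every phase.
* `not_rigid_two_hardSpheres_example` (`L = 13/20`), `groundStateRigidity_finiteEnergy_strengthening_false` — the
  natural strengthening "admissible `v`, `N ≥ 1`, `L > 0`, `E₀(N,L) < ⊤` ⇒ rigid" of the crux is FALSE.
* `not_hasUniqueGroundState_two` — **an admissible `v` and a finite-energy box with a DEGENERATE closed-form ground
  state**: `¬ HasUniqueGroundState hardSphere 2 (13/20)` (by the landed line stubs `stub_rigidityOfUnique`,
  `stub_compactness`: uniqueness would give rigidity).  So uniqueness for unbounded admissible `v` — the open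
  kernel `stub_uniquenessKernel` of line `Sketch` — is genuinely density-dependent: it must use `ρ < ρ₀` and
  `N → ∞`, not just `E₀ < ⊤`.

None of this refutes the crux, which lives at `L = (N/ρ)^{1/3} → ∞`, `ρ < ρ₀(v)`.
-/

noncomputable section

namespace Summit.AtomisticToContinuum.BoseEinsteinCondensation.Theorems.GroundStateRigidity.Negative.TwoHardSpheres

open Literature.MathematicalPhysics.QuantumManyBody.BoseGas
open MeasureTheory Filter Metric
open scoped ENNReal NNReal Topology

variable {N : ℕ}

/-! ### Disjointly supported near-minimisers defeat rigidity -/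

/-- **No rigidity from disjoint near-minimisers.** If at every slack `δ > 0` there are two
`δ`-near-minimisers with disjoint supports, rigidity fails at `(v, N, L)` (take `η = 1`: their squared
distance is `2 > 1` for every phase, `Negative.lintegral_sub_mul_sq_eq_two`). -/
theorem not_rigid_of_disjoint {v : ℝ → ℝ≥0∞} {L : ℝ}
    (h : ∀ δ : ℝ≥0∞, 0 < δ → ∃ Ψ Φ : TrialState N L, (∀ X, Ψ.ψ X = 0 ∨ Φ.ψ X = 0) ∧
      energy v Ψ ≤ groundStateEnergy v N L + δ ∧ energy v Φ ≤ groundStateEnergy v N L + δ) :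
    ¬ (∀ η : ℝ, 0 < η → ∃ δ : ℝ≥0∞, 0 < δ ∧ ∀ Ψ Φ : TrialState N L,
        energy v Ψ ≤ groundStateEnergy v N L + δ → energy v Φ ≤ groundStateEnergy v N L + δ →
        ∃ c : ℂ, ‖c‖ = 1 ∧ ∫⁻ X, (‖Ψ.ψ X - c * Φ.ψ X‖₊ : ℝ≥0∞) ^ 2 ≤ ENNReal.ofReal η) := by
  intro hR
  obtain ⟨δ, hδ, hΨΦ⟩ := hR 1 one_pos
  obtain ⟨Ψ, Φ, hdisj, hΨ, hΦ⟩ := h δ hδ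
  obtain ⟨c, hc, hle⟩ := hΨΦ Ψ Φ hΨ hΦ
  rw [Negative.lintegral_sub_mul_sq_eq_two Ψ Φ hdisj hc, ENNReal.ofReal_one] at hle
  exact absurd hle (by norm_num)

/-! ### Finite ground-state energy: a witness near opposite corners -/

/-- A one-particle trial state has finite energy (no interaction — Literature `BoseGas.interaction_one` —,
finite kinetic energy). -/
theorem energy_one_ne_top (v : ℝ → ℝ≥0∞) {L : ℝ} (Ψ : TrialState 1 L) : energy v Ψ ≠ ⊤ := by
  unfold energy
  simp only [interaction_one, zero_mul, add_zero]
  exact (TrialState.lintegral_kineticDensity_lt_top Ψ).ne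

/-- **`E₀ < ⊤` for two unit hard spheres when `3L² > 1`**: a symmetrised product of one-particle
states near the corners `0` and `(L,L,L)` has finite energy. -/
theorem groundStateEnergy_two_ne_top {L : ℝ} (hL0 : 0 < L) (hL : 1 < 3 * L ^ 2) :
    groundStateEnergy hardSphere 2 L ≠ ⊤ := by
  -- a number `t` with `1/3 < t² < L²`, `0 < t < L`
  set t : ℝ := Real.sqrt ((1 / 3 + L ^ 2) / 2) with ht
  have ht2 : t ^ 2 = (1 / 3 + L ^ 2) / 2 := Real.sq_sqrt (by positivity)
  have ht0 : 0 < t := Real.sqrt_pos.2 (by positivity)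
  have htL : t < L := by nlinarith
  have ht3 : 1 < 3 * t ^ 2 := by nlinarith
  set ε : ℝ := (L - t) / 2 with hε
  have hε0 : 0 < ε := by linarith
  have hεL : ε ≤ L := by linarith
  -- one-particle states in the small boxes
  obtain ⟨Ψ₀⟩ := TrialState.nonempty (N := 1) one_pos hε0
  let a : Space := WithLp.toLp 2 fun _ : Fin 3 => L - ε
  let S₁ : Set Space := box ε
  let S₂ : Set Space := {x | x - a ∈ box ε}
  have hS₂L : S₂ ⊆ box L := by
    intro x hx k
    have hk := hx k
    simp only [a, PiLp.sub_apply, Set.mem_Ioo] at hk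
    constructor <;> linarith [hk.1, hk.2]
  let Ψ₁ : TrialState 1 L := Ψ₀.enlarge hεL
  let Ψ₂ : TrialState 1 L := ((Ψ₀.toSupported.translate a).mono hS₂L).toTrialState
  have hS₁ : ∀ Y : Config 1, (∃ i, Y i ∉ S₁) → Ψ₁.ψ Y = 0 := by
    rintro Y ⟨i, hi⟩
    exact Ψ₀.eq_zero Y (fun h => hi (h i))
  have hS₂ : ∀ Y : Config 1, (∃ i, Y i ∉ S₂) → Ψ₂.ψ Y = 0 := by
    rintro Y ⟨i, hi⟩
    exact (Ψ₀.toSupported.translate a).eq_zero Y ⟨i, hi⟩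
  have hdisj : Disjoint (closure S₁) (closure S₂) := by
    have h1 : closure S₁ ⊆ {x : Space | x 0 ≤ ε} :=
      closure_minimal (fun x hx => (hx 0).2.le) (isClosed_le (by fun_prop) continuous_const)
    have h2 : closure S₂ ⊆ {x : Space | L - ε ≤ x 0} := by
      refine closure_minimal (fun x hx => ?_) (isClosed_le continuous_const (by fun_prop))
      have := (hx 0).1
      simp only [a, PiLp.sub_apply] at this
      show L - ε ≤ x 0
      linarith
    refine Set.disjoint_of_subset h1 h2 (Set.disjoint_left.2 fun x hx hx' => ?_)
    simp only [Set.mem_setOf_eq] at hx hx'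
    linarith
  have hsep : ∀ x ∈ S₁, ∀ y ∈ S₂, (1 : ℝ) < dist x y := by
    intro x hx y hy
    rw [EuclideanSpace.dist_eq, Real.lt_sqrt (by norm_num)]
    have hk : ∀ k : Fin 3, t ^ 2 < dist (x k) (y k) ^ 2 := by
      intro k
      have h1 := (hx k).2
      have h2 := (hy k).1
      simp only [a, PiLp.sub_apply] at h2
      rw [Real.dist_eq, sq_abs]
      nlinarith
    calc (1 : ℝ) ^ 2 < 3 * t ^ 2 := by linarith
      _ = ∑ _k : Fin 3, t ^ 2 := by simp [Finset.sum_const]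
      _ ≤ ∑ k, dist (x k) (y k) ^ 2 := Finset.sum_le_sum fun k _ => (hk k).le
  have hvR : ∀ r, (1 : ℝ) < r → hardSphere r = 0 := fun r hr => by simp [hardSphere, not_le.2 hr]
  have hcomb := TrialState.energy_combine Ψ₁ Ψ₂ hS₁ hS₂ hdisj isRepulsiveFiniteRange_hardSphere.1 hvR hsep
  have hfin : energy hardSphere (Ψ₁.combine Ψ₂ hS₁ hS₂ hdisj) ≠ ⊤ := by
    rw [hcomb]
    exact ENNReal.add_ne_top.2 ⟨energy_one_ne_top _ Ψ₁, energy_one_ne_top _ Ψ₂⟩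
  have hle : groundStateEnergy hardSphere 2 L ≤ energy hardSphere (Ψ₁.combine Ψ₂ hS₁ hS₂ hdisj) :=
    groundStateEnergy_le_energy hardSphere _
  exact ne_top_of_le_ne_top hfin hle


/-! ### Assembly: no rigidity for two unit hard spheres in a box with `1/3 < L² < 1/2` -/

/-- **Core step**: a near-minimiser whose `{q > 0}` half carries mass `≥ 1/2` yields two DISJOINTLY
supported near-minimisers (its localisation and the reflection of that) at twice the slack. -/
theorem exists_disjoint_pair {L : ℝ} (hL : 2 * L ^ 2 < 1) {ε : ℝ≥0∞} (Φ : TrialState 2 L)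
    (hEΦ : energy hardSphere Φ ≤ groundStateEnergy hardSphere 2 L + ε)
    (hE0 : groundStateEnergy hardSphere 2 L ≠ ⊤) (hεt : ε ≠ ⊤) (hm : 2⁻¹ ≤ halfMass Φ) :
    ∃ Ψ₁ Ψ₂ : TrialState 2 L, (∀ X, Ψ₁.ψ X = 0 ∨ Ψ₂.ψ X = 0) ∧
      energy hardSphere Ψ₁ ≤ groundStateEnergy hardSphere 2 L + 2 * ε ∧
      energy hardSphere Ψ₂ ≤ groundStateEnergy hardSphere 2 L + 2 * ε := by
  set E₀ := groundStateEnergy hardSphere 2 L with hE₀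
  have hg : 0 < thr L := by unfold thr; linarith
  have hΦt : energy hardSphere Φ ≠ ⊤ :=
    ne_top_of_le_ne_top (ENNReal.add_ne_top.2 ⟨hE0, hεt⟩) hEΦ
  have hm0 : halfMass Φ ≠ 0 := by
    intro h
    rw [h] at hm
    exact absurd hm (by norm_num)
  have hmt : halfMass Φ ≠ ⊤ := halfMass_ne_top Φ
  set Ψ₁ := locTS Φ hm0 with hΨ₁
  -- energy of the localisation
  have hE1 : energy hardSphere Ψ₁ ≤ E₀ + 2 * ε := by
    have hsumM := halfMass_add hL Φ hΦt
    have hsumE := halfEnergy_add hL Φ hΦt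
    have hΦ't : energy hardSphere (reflectTS Φ) ≠ ⊤ := by rwa [energy_reflectTS]
    have hlow : halfMass (reflectTS Φ) * E₀ ≤ halfEnergy (reflectTS Φ) :=
      halfMass_mul_le_halfEnergy hL (reflectTS Φ) hΦ't
    have hm't : halfMass (reflectTS Φ) * E₀ ≠ ⊤ := ENNReal.mul_ne_top (halfMass_ne_top _) hE0
    -- halfEnergy Φ ≤ m E₀ + ε
    have hkey : halfEnergy Φ ≤ halfMass Φ * E₀ + ε := by
      have h1 : halfEnergy Φ + halfMass (reflectTS Φ) * E₀ ≤ halfMass Φ * E₀ + ε +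
          halfMass (reflectTS Φ) * E₀ := by
        calc halfEnergy Φ + halfMass (reflectTS Φ) * E₀
            ≤ halfEnergy Φ + halfEnergy (reflectTS Φ) := add_le_add le_rfl hlow
          _ = energy hardSphere Φ := hsumE
          _ ≤ E₀ + ε := hEΦ
          _ = (halfMass Φ + halfMass (reflectTS Φ)) * E₀ + ε := by rw [hsumM, one_mul]
          _ = halfMass Φ * E₀ + ε + halfMass (reflectTS Φ) * E₀ := by rw [add_mul]; ring
      exact (ENNReal.add_le_add_iff_right hm't).1 h1
    calc energy hardSphere Ψ₁ = (halfMass Φ)⁻¹ * halfEnergy Φ := energy_locTS hL Φ hΦt hm0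
      _ ≤ (halfMass Φ)⁻¹ * (halfMass Φ * E₀ + ε) := mul_le_mul' le_rfl hkey
      _ = E₀ + (halfMass Φ)⁻¹ * ε := by
          rw [mul_add, ← mul_assoc, ENNReal.inv_mul_cancel hm0 hmt, one_mul]
      _ ≤ E₀ + 2 * ε := by
          gcongr
          calc (halfMass Φ)⁻¹ ≤ (2⁻¹ : ℝ≥0∞)⁻¹ := ENNReal.inv_le_inv.2 hm
            _ = 2 := inv_inv 2
  refine ⟨Ψ₁, reflectTS Ψ₁, fun X => ?_, hE1, by rw [energy_reflectTS]; exact hE1⟩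
  by_contra hX
  push Not at hX
  have h1 : thr L < qfun X := thr_lt_qfun_of_locTS_ne_zero hL Φ hΦt hm0 hX.1
  have h2 : thr L < qfun (reflC L X) := thr_lt_qfun_of_locTS_ne_zero hL Φ hΦt hm0 hX.2
  rw [qfun_reflC] at h2
  linarith

/-- **Two unit hard spheres in a box with `1/3 < L² < 1/2` have NO rigid ground state**: `E₀ < ⊤`,
yet at every slack there are two disjointly supported near-minimisers (localise any near-minimiser
to the heavier of the two classes `{q > 0}`, `{q < 0}` of the disconnected free region, and reflect it
in the plane `x₀ = L/2`), so the rigidity conclusion of the crux fails at `(hardSphere, 2, L)`. -/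
theorem not_rigid_two_hardSpheres {L : ℝ} (hL0 : 0 < L) (h3 : 1 < 3 * L ^ 2)
    (h2 : 2 * L ^ 2 < 1) :
    ¬ (∀ η : ℝ, 0 < η → ∃ δ : ℝ≥0∞, 0 < δ ∧ ∀ Ψ Φ : TrialState 2 L,
        energy hardSphere Ψ ≤ groundStateEnergy hardSphere 2 L + δ →
        energy hardSphere Φ ≤ groundStateEnergy hardSphere 2 L + δ →
        ∃ c : ℂ, ‖c‖ = 1 ∧ ∫⁻ X, (‖Ψ.ψ X - c * Φ.ψ X‖₊ : ℝ≥0∞) ^ 2 ≤ ENNReal.ofReal η) := by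
  apply not_rigid_of_disjoint
  intro δ hδ
  have hE0 := groundStateEnergy_two_ne_top hL0 h3
  -- slack `ε = min δ 1 / 2`
  set ε : ℝ≥0∞ := min δ 1 / 2 with hε
  have hmin0 : min δ 1 ≠ 0 := (lt_min hδ one_pos).ne'
  have hmint : min δ 1 ≠ ⊤ := ne_top_of_le_ne_top ENNReal.one_ne_top (min_le_right _ _)
  have hε0 : 0 < ε := ENNReal.div_pos hmin0 (by norm_num)
  have hεt : ε ≠ ⊤ := ENNReal.div_ne_top hmint (by norm_num)
  have h2ε : 2 * ε ≤ δ := by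
    rw [hε, ENNReal.mul_div_cancel (by norm_num) (by norm_num)]
    exact min_le_left _ _
  -- a near-minimiser at slack `ε`
  obtain ⟨Φ, hΦ⟩ : ∃ Φ : TrialState 2 L,
      energy hardSphere Φ < groundStateEnergy hardSphere 2 L + ε :=
    iInf_lt_iff.1 (ENNReal.lt_add_right hE0 hε0.ne')
  have hΦt : energy hardSphere Φ ≠ ⊤ :=
    ne_top_of_lt (hΦ.trans_le le_top)
  have hsum := halfMass_add h2 Φ hΦt
  by_cases hm : 2⁻¹ ≤ halfMass Φ
  · obtain ⟨Ψ₁, Ψ₂, hd, e1, e2⟩ := exists_disjoint_pair h2 Φ hΦ.le hE0 hεt hm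
    exact ⟨Ψ₁, Ψ₂, hd, e1.trans (add_le_add le_rfl h2ε), e2.trans (add_le_add le_rfl h2ε)⟩
  · have hm' : 2⁻¹ ≤ halfMass (reflectTS Φ) := by
      by_contra h
      push Not at hm h
      have : halfMass Φ + halfMass (reflectTS Φ) < 2⁻¹ + 2⁻¹ := ENNReal.add_lt_add hm h
      rw [hsum, ENNReal.inv_two_add_inv_two] at this
      exact lt_irrefl _ this
    have hΦ' : energy hardSphere (reflectTS Φ) ≤ groundStateEnergy hardSphere 2 L + ε := by
      rw [energy_reflectTS]
      exact hΦ.le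
    obtain ⟨Ψ₁, Ψ₂, hd, e1, e2⟩ := exists_disjoint_pair h2 (reflectTS Φ) hΦ' hE0 hεt hm'
    exact ⟨Ψ₁, Ψ₂, hd, e1.trans (add_le_add le_rfl h2ε), e2.trans (add_le_add le_rfl h2ε)⟩

/-- The window is nonempty: `L = 13/20` has `3L² = 1.2675 > 1` and `2L² = 0.845 < 1`, so at
`(hardSphere, 2, 13/20)` the rigidity conclusion of the crux fails. -/
theorem not_rigid_two_hardSpheres_example :
    ¬ (∀ η : ℝ, 0 < η → ∃ δ : ℝ≥0∞, 0 < δ ∧ ∀ Ψ Φ : TrialState 2 (13 / 20),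
        energy hardSphere Ψ ≤ groundStateEnergy hardSphere 2 (13 / 20) + δ →
        energy hardSphere Φ ≤ groundStateEnergy hardSphere 2 (13 / 20) + δ →
        ∃ c : ℂ, ‖c‖ = 1 ∧ ∫⁻ X, (‖Ψ.ψ X - c * Φ.ψ X‖₊ : ℝ≥0∞) ^ 2 ≤ ENNReal.ofReal η) :=
  not_rigid_two_hardSpheres (by norm_num) (by norm_num) (by norm_num)

/-- **The finite-energy strengthening of `GroundStateRigidity` is false**: it is NOT true that for every
admissible `v`, every `N ≥ 1` and every box `L > 0` with `E₀(N, L) < ⊤` near-minimisers are rigid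
(witness: unit hard spheres, `N = 2`, `L = 13/20`).  So the crux must use `ρ < ρ₀` and `N → ∞`. -/
theorem groundStateRigidity_finiteEnergy_strengthening_false :
    ¬ (∀ v : ℝ → ℝ≥0∞, IsRepulsiveFiniteRange v → ∀ N : ℕ, 1 ≤ N → ∀ L : ℝ, 0 < L →
        groundStateEnergy v N L ≠ ⊤ →
        ∀ η : ℝ, 0 < η → ∃ δ : ℝ≥0∞, 0 < δ ∧ ∀ Ψ Φ : TrialState N L,
          energy v Ψ ≤ groundStateEnergy v N L + δ → energy v Φ ≤ groundStateEnergy v N L + δ →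
          ∃ c : ℂ, ‖c‖ = 1 ∧ ∫⁻ X, (‖Ψ.ψ X - c * Φ.ψ X‖₊ : ℝ≥0∞) ^ 2 ≤ ENNReal.ofReal η) := by
  intro h
  exact not_rigid_two_hardSpheres_example
    (h hardSphere isRepulsiveFiniteRange_hardSphere 2 (by norm_num) (13 / 20) (by norm_num)
      (groundStateEnergy_two_ne_top (by norm_num) (by norm_num)))

/-- **An admissible interaction and a finite-energy box with a DEGENERATE closed-form ground state**:
`¬ HasUniqueGroundState hardSphere 2 (13/20)`.  For by the landed stubs of line `Sketch`
(`stub_rigidityOfUnique` fed with `stub_compactness`, Theorems files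
`BECCutLineWeakDisorderGroundStateRigidityStubRigidityOfUnique/StubCompactness`) uniqueness of the
closed-form ground state implies rigidity of near-minimisers, which fails here.  Hence uniqueness for
unbounded admissible `v` (the open kernel of the crux) is density-dependent. -/
theorem not_hasUniqueGroundState_two : ¬ HasUniqueGroundState hardSphere 2 (13 / 20) := fun hU =>
  not_rigid_two_hardSpheres_example
    (GroundStateRigidity.stub_rigidityOfUnique GroundStateRigidity.stub_compactness hardSphere 2 (13 / 20) hU)

/-- **Uniqueness of the closed-form ground state is NOT a consequence of admissibility and finite energy**:
it is false that every admissible `v`, `N ≥ 1`, `L > 0` with `E₀(N, L) < ⊤` has `HasUniqueGroundState v N L`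
(witness `hardSphere`, `N = 2`, `L = 13/20`).  Any proof of the uniqueness kernel of the crux must therefore
use low density and `N → ∞`. -/
theorem hasUniqueGroundState_finiteEnergy_strengthening_false :
    ¬ (∀ v : ℝ → ℝ≥0∞, IsRepulsiveFiniteRange v → ∀ N : ℕ, 1 ≤ N → ∀ L : ℝ, 0 < L →
        groundStateEnergy v N L ≠ ⊤ → HasUniqueGroundState v N L) := fun h =>
  not_hasUniqueGroundState_two
    (h hardSphere isRepulsiveFiniteRange_hardSphere 2 (by norm_num) (13 / 20) (by norm_num)
      (groundStateEnergy_two_ne_top (by norm_num) (by norm_num)))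

end Summit.AtomisticToContinuum.BoseEinsteinCondensation.Theorems.GroundStateRigidity.Negative.TwoHardSpheres

end
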